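import Summits.QuantumFields.QCD.Theorems.ExtinctionBuildsQCD.Negative.VolumeLever

/-!
# `ExtinctionBuildsQCD` (crux stmt-QuantumFields-18064, SD⁺ → THR) — negative-side support:
# the VOLUME-GROWTH FLOOR `a_k L_k / Z_k → ∞` is SAFE (not junk-excluding) and SUFFICIENT for the
# boundary-condition transfer

Cdisprove seat g4 (2026-08-17), §10 of `Cruxes/ExtinctionBuildsQCD/Disproof.lean`; companion of
`Negative/VolumeFloor` (g2, §8b).  The line lead's hand-back (`Lines/block-away-the-sign-c3.md` §3(c)) and the
disprover (§8b) recommend adding the clause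

  `GROWTH : Tendsto (fun k => reg.a k * reg.L k / reg.Zm k) atTop atTop`

to the SD⁺ class of stmt-18063/18064, so that the landed Weyl-type transfer stubs W
(`stub_indexAPSubPerLeWindow`) and F (`stub_apSignDefectForcesPerDefect`, proviso `C₀ / L < c·w` at the bare
flavour scale `w = a_k m_f/Z_k`) bite at the scheme torus.  `Negative/VolumeFloor` showed that SD⁺ minus TIGHT⁺
does NOT supply the proviso (slow-volume tip family).  This module records the two facts a planner needs before
adding the clause:

* `bcProviso_eventually_of_growth` — GROWTH is SUFFICIENT: along any regularisation with GROWTH, for every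
  constant `C₀`, every `c > 0` and every mass `m > 0`, eventually `C₀/(2L_k+1) < c·(a_k m/Z_k)` (F's proviso at
  the scheme torus, W's window `C₀/(2L_k+1)` inside the coercivity collar).
* `tendsto_canonicalAF_growth`, `sdPlusGrowthWithoutTight_canonicalAF`, `bridge_growthWithoutTight_iff` — GROWTH
  is SAFE but NOT JUNK-EXCLUDING: the standard junk witness `canonicalAF` (line at bare mass `0`, `L_k = a_k⁻²`)
  meets GROWTH together with leading-log mass scaling, asymptotic scaling, the polynomial cap (`p = 2`), the
  branch clause and EXTINCT for every `c ≤ 1` and every positive tuple; hence the bridge over the class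
  "SD⁺ with TIGHT⁺ replaced by GROWTH" to ANY conclusion `Q N_f` is equivalent to `Q 2 ∧ Q 3` — with `Q = THR`
  this is the restated crux's conclusion outright.  So after the addition TIGHT⁺ remains the ONLY load-bearing
  (junk-excluding) clause of the hypothesis (`Negative/WithoutTightPlusCollapse`), every landed collapse /
  load-bearing result persists verbatim, and CAP ∧ GROWTH are jointly consistent (same witness).

No hypothesis on `N_f` is needed: `(log x)^γ = o(x^{1/2})` for every real `γ`.
-/

namespace Summit.QuantumFields.QCD.Theorems.ExtinctionBuildsQCD.Negative.VolumeGrowth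

open scoped Topology
open Filter Asymptotics
open Literature.MathematicalPhysics.QuantumLattice Literature.MathematicalPhysics.QuantumFieldTheory
  Literature.Probability.LatticeModels
open Summit.QuantumFields.QCD.Theses.SpectralDefectExtinction
open Summit.QuantumFields.QCD.Theorems.ExtinctionBuildsQCD.Negative

variable {Nf : ℕ}

/-! ## GROWTH is sufficient for the b.c. proviso -/

/-- **GROWTH supplies the boundary-condition proviso at the scheme torus.**  If `a_k L_k / Z_k → ∞` then for
every constant `C₀` (F's `8π`), every `c > 0` and every `m > 0`, eventually `C₀/(2L_k+1) < c·(a_k m/Z_k)`. -/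
theorem bcProviso_eventually_of_growth (reg : QCDRegularisation Nf)
    (h : Tendsto (fun k => reg.a k * reg.L k / reg.Zm k) atTop atTop) (C₀ : ℝ) {c m : ℝ} (hc : 0 < c)
    (hm : 0 < m) :
    ∀ᶠ k : ℕ in atTop, C₀ / (2 * reg.L k + 1 : ℝ) < c * (reg.a k * m / reg.Zm k) := by
  filter_upwards [h.eventually_ge_atTop (C₀ / (c * m) + 1)] with k hk
  have ha := reg.a_pos k
  have hZ := reg.Zm_pos k
  have hN : (0 : ℝ) < 2 * reg.L k + 1 := by positivity
  have hcm : 0 < c * m := mul_pos hc hm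
  -- `C₀ < c m · (a L / Z)`
  have h1 : C₀ < c * m * (reg.a k * reg.L k / reg.Zm k) := by
    have : C₀ / (c * m) < reg.a k * reg.L k / reg.Zm k := by linarith
    rwa [div_lt_iff₀' hcm] at this
  -- `c m · (a L / Z) ≤ c (a m / Z) (2L+1)`
  have h2 : c * m * (reg.a k * reg.L k / reg.Zm k) ≤ c * (reg.a k * m / reg.Zm k) * (2 * reg.L k + 1) := by
    have key : c * (reg.a k * m / reg.Zm k) * (2 * reg.L k + 1) - c * m * (reg.a k * reg.L k / reg.Zm k) =
        c * m * (reg.a k / reg.Zm k) * (reg.L k + 1) := by ring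
    have : 0 ≤ c * m * (reg.a k / reg.Zm k) * (reg.L k + 1) := by positivity
    linarith
  rw [div_lt_iff₀ hN]
  exact h1.trans_le h2

/-! ## GROWTH is met by the junk witness `canonicalAF` -/

/-- Growth comparison behind `canonicalAF`: `(k+1) / (log (k+1)²)^γ → ∞` for every real `γ`. -/
theorem tendsto_linear_div_log_sq_rpow (γ : ℝ) :
    Tendsto (fun k : ℕ => ((k : ℝ) + 1) / Real.log (((k : ℝ) + 1) ^ 2) ^ γ) atTop atTop := by
  have h1 : Tendsto (fun k : ℕ => ((k : ℝ) + 1) ^ 2) atTop atTop :=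
    (tendsto_pow_atTop two_ne_zero).comp (tendsto_natCast_atTop_atTop.atTop_add tendsto_const_nhds)
  have h2 : Tendsto (fun x : ℝ => Real.log x ^ γ / x ^ (1 / 2 : ℝ)) atTop (𝓝 0) :=
    (isLittleO_log_rpow_rpow_atTop γ (by norm_num : (0 : ℝ) < 1 / 2)).tendsto_div_nhds_zero
  have h3 : Tendsto (fun k : ℕ => Real.log (((k : ℝ) + 1) ^ 2) ^ γ / ((k : ℝ) + 1)) atTop (𝓝 0) := by
    refine (h2.comp h1).congr fun k => ?_
    simp only [Function.comp_def]
    rw [← Real.sqrt_eq_rpow, Real.sqrt_sq (by positivity)]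
  have h4 : ∀ᶠ k : ℕ in atTop, Real.log (((k : ℝ) + 1) ^ 2) ^ γ / ((k : ℝ) + 1) ∈ Set.Ioi 0 := by
    filter_upwards [eventually_ne_atTop 0] with k hk
    have hk1 : (1 : ℝ) ≤ k := by exact_mod_cast Nat.pos_of_ne_zero hk
    have hlog : 0 < Real.log (((k : ℝ) + 1) ^ 2) := Real.log_pos (by nlinarith)
    exact div_pos (Real.rpow_pos_of_pos hlog _) (by positivity)
  have h5 : Tendsto (fun k : ℕ => Real.log (((k : ℝ) + 1) ^ 2) ^ γ / ((k : ℝ) + 1)) atTop (𝓝[>] 0) :=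
    tendsto_nhdsWithin_iff.2 ⟨h3, h4⟩
  refine h5.inv_tendsto_nhdsGT_zero.congr fun k => ?_
  simp only [Pi.inv_apply, inv_div]

variable (Nf) in
/-- **`canonicalAF` meets GROWTH**: `a_k L_k / Z_k = (k+1)/(log (k+1)²)^{γ₀/2β₀} → ∞`. -/
theorem tendsto_canonicalAF_growth :
    Tendsto (fun k => (QCDRegularisation.canonicalAF Nf).a k * (QCDRegularisation.canonicalAF Nf).L k /
      (QCDRegularisation.canonicalAF Nf).Zm k) atTop atTop := by
  refine (tendsto_linear_div_log_sq_rpow (massExponent Nf)).congr' ?_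
  filter_upwards [eventually_ne_atTop 0] with k hk
  have ha : (QCDRegularisation.canonicalAF Nf).a k = ((k : ℝ) + 1)⁻¹ := rfl
  have hL : ((QCDRegularisation.canonicalAF Nf).L k : ℝ) = ((k : ℝ) + 1) ^ 2 := by
    change (((k + 1) ^ 2 : ℕ) : ℝ) = _
    push_cast
    ring
  have hZ : (QCDRegularisation.canonicalAF Nf).Zm k = Real.log (((k : ℝ) + 1) ^ 2) ^ massExponent Nf := by
    change (if k = 0 then (1 : ℝ) else Real.log (1 / (QCDScheme.zeroAF Nf).a k ^ 2) ^ massExponent Nf) = _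
    rw [if_neg hk]
    congr 2
    change 1 / (((k : ℝ) + 1)⁻¹) ^ 2 = _
    rw [inv_pow, one_div, inv_inv]
  rw [ha, hL, hZ]
  congr 1
  have hk1 : ((k : ℝ) + 1) ≠ 0 := by positivity
  field_simp

variable (Nf) in
/-- **The junk witness meets every clause of "SD⁺ with TIGHT⁺ replaced by GROWTH"**: leading-log mass scaling,
asymptotic scaling, the polynomial volume cap (`p = 2`), the branch clause, GROWTH, and EXTINCT for every
`c ≤ 1` and every positive mass tuple (the defect integrand vanishes identically on the line at bare mass `0`). -/
theorem sdPlusGrowthWithoutTight_canonicalAF :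
    (QCDRegularisation.canonicalAF Nf).HasMassScaling ∧
      ((QCDRegularisation.canonicalAF Nf).scheme 0 0 0).HasAsymptoticScaling ∧
      (∃ p : ℕ, ∀ᶠ k : ℕ in atTop, ((QCDRegularisation.canonicalAF Nf).L k : ℝ) ≤
        ((QCDRegularisation.canonicalAF Nf).a k)⁻¹ ^ p) ∧
      (∀ᶠ k : ℕ in atTop, -1 < (QCDRegularisation.canonicalAF Nf).mcrit k) ∧
      Tendsto (fun k => (QCDRegularisation.canonicalAF Nf).a k * (QCDRegularisation.canonicalAF Nf).L k /
        (QCDRegularisation.canonicalAF Nf).Zm k) atTop atTop ∧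
      ∀ c : ℝ, c ≤ 1 → ∀ m : Fin Nf → ℝ, (∀ f, 0 < m f) → Extinct Nf (QCDRegularisation.canonicalAF Nf) c m :=
  ⟨QCDRegularisation.canonicalAF_hasMassScaling, QCDScheme.zeroAF_hasAsymptoticScaling,
    ⟨2, Eventually.of_forall fun k => by
      simp [QCDRegularisation.canonicalAF, QCDScheme.zeroAF, SpeciesScheme.zero]⟩,
    Eventually.of_forall fun _ => by norm_num [QCDRegularisation.canonicalAF],
    tendsto_canonicalAF_growth Nf,
    fun _ hc m hm => extinct_of_mcrit_nonneg _ (fun _ => le_rfl) hc m hm⟩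

variable (Nf) in
/-- The class "SD⁺ with TIGHT⁺ replaced by GROWTH" (threshold form, `∃ M₀ ≥ 0, ∃ c > 0, ∀ m > M₀, EXTINCT`) is
inhabited at EVERY flavour number. -/
theorem sdPlusGrowthWithoutTight_inhabited :
    ∃ reg : QCDRegularisation Nf, reg.HasMassScaling ∧ (reg.scheme 0 0 0).HasAsymptoticScaling ∧
      (∃ p : ℕ, ∀ᶠ k : ℕ in atTop, (reg.L k : ℝ) ≤ (reg.a k)⁻¹ ^ p) ∧ (∀ᶠ k : ℕ in atTop, -1 < reg.mcrit k) ∧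
      Tendsto (fun k => reg.a k * reg.L k / reg.Zm k) atTop atTop ∧
      ∃ M₀ : ℝ, 0 ≤ M₀ ∧ ∃ c : ℝ, 0 < c ∧ ∀ m : Fin Nf → ℝ, (∀ f, M₀ < m f) → Extinct Nf reg c m := by
  obtain ⟨h1, h2, h3, h4, h5, h6⟩ := sdPlusGrowthWithoutTight_canonicalAF Nf
  exact ⟨_, h1, h2, h3, h4, h5, 0, le_rfl, 1, one_pos, fun m hm => h6 1 le_rfl m hm⟩

/-- **LOAD-BEARING (collapse schema with GROWTH).**  For ANY family of conclusions `Q`, the bridge over the class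
"SD⁺ with TIGHT⁺ replaced by GROWTH" is equivalent to `Q 2 ∧ Q 3`; with `Q N_f :=` the THR body this is the
restated crux's conclusion outright.  GROWTH is therefore NOT junk-excluding: after its addition to SD⁺, TIGHT⁺
remains the only clause from which a proof of `ExtinctionBuildsQCD` can extract fermionic input. -/
theorem bridge_growthWithoutTight_iff (Q : ℕ → Prop) :
    (∀ Nf : ℕ, (Nf = 2 ∨ Nf = 3) →
      (∃ reg : QCDRegularisation Nf, reg.HasMassScaling ∧ (reg.scheme 0 0 0).HasAsymptoticScaling ∧
        (∃ p : ℕ, ∀ᶠ k : ℕ in atTop, (reg.L k : ℝ) ≤ (reg.a k)⁻¹ ^ p) ∧ (∀ᶠ k : ℕ in atTop, -1 < reg.mcrit k) ∧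
        Tendsto (fun k => reg.a k * reg.L k / reg.Zm k) atTop atTop ∧
        ∃ M₀ : ℝ, 0 ≤ M₀ ∧ ∃ c : ℝ, 0 < c ∧ ∀ m : Fin Nf → ℝ, (∀ f, M₀ < m f) → Extinct Nf reg c m) → Q Nf) ↔
      Q 2 ∧ Q 3 :=
  ⟨fun h => ⟨h 2 (Or.inl rfl) (sdPlusGrowthWithoutTight_inhabited 2),
      h 3 (Or.inr rfl) (sdPlusGrowthWithoutTight_inhabited 3)⟩,
    fun hq Nf hNf _ => by
      rcases hNf with rfl | rfl
      exacts [hq.1, hq.2]⟩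

/-- **Collapse schema, general form.**  Replacing TIGHT⁺ by ANY side condition `P` met by `canonicalAF` — on top of
cap, branch AND growth — still yields a bridge equivalent to its conclusion at `N_f = 2, 3`. -/
theorem bridge_collapse_schema_with_growth (P : ∀ Nf : ℕ, QCDRegularisation Nf → Prop)
    (hP : ∀ Nf, P Nf (QCDRegularisation.canonicalAF Nf)) (Q : ℕ → Prop) :
    (∀ Nf : ℕ, (Nf = 2 ∨ Nf = 3) →
      (∃ reg : QCDRegularisation Nf, P Nf reg ∧ reg.HasMassScaling ∧ (reg.scheme 0 0 0).HasAsymptoticScaling ∧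
        (∃ p : ℕ, ∀ᶠ k : ℕ in atTop, (reg.L k : ℝ) ≤ (reg.a k)⁻¹ ^ p) ∧ (∀ᶠ k : ℕ in atTop, -1 < reg.mcrit k) ∧
        Tendsto (fun k => reg.a k * reg.L k / reg.Zm k) atTop atTop ∧
        ∃ M₀ : ℝ, 0 ≤ M₀ ∧ ∃ c : ℝ, 0 < c ∧ ∀ m : Fin Nf → ℝ, (∀ f, M₀ < m f) → Extinct Nf reg c m) → Q Nf) ↔
      Q 2 ∧ Q 3 := by
  have hw : ∀ Nf, ∃ reg : QCDRegularisation Nf, P Nf reg ∧ reg.HasMassScaling ∧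
      (reg.scheme 0 0 0).HasAsymptoticScaling ∧
        (∃ p : ℕ, ∀ᶠ k : ℕ in atTop, (reg.L k : ℝ) ≤ (reg.a k)⁻¹ ^ p) ∧ (∀ᶠ k : ℕ in atTop, -1 < reg.mcrit k) ∧
        Tendsto (fun k => reg.a k * reg.L k / reg.Zm k) atTop atTop ∧
        ∃ M₀ : ℝ, 0 ≤ M₀ ∧ ∃ c : ℝ, 0 < c ∧ ∀ m : Fin Nf → ℝ, (∀ f, M₀ < m f) → Extinct Nf reg c m := fun Nf => by
    obtain ⟨h1, h2, h3, h4, h5, h6⟩ := sdPlusGrowthWithoutTight_canonicalAF Nf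
    exact ⟨_, hP Nf, h1, h2, h3, h4, h5, 0, le_rfl, 1, one_pos, fun m hm => h6 1 le_rfl m hm⟩
  exact ⟨fun h => ⟨h 2 (Or.inl rfl) (hw 2), h 3 (Or.inr rfl) (hw 3)⟩,
    fun hq Nf hNf _ => by
      rcases hNf with rfl | rfl
      exacts [hq.1, hq.2]⟩

/-- **GROWTH on the junk witness makes F's proviso hold there too** — so the proviso itself is not junk-excluding
either: on `canonicalAF`, for every `C₀`, `c > 0`, `m > 0`, eventually `C₀/(2L_k+1) < c·(a_k m/Z_k)`. -/
theorem canonicalAF_bcProviso_eventually (C₀ : ℝ) {c m : ℝ} (hc : 0 < c) (hm : 0 < m) :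
    ∀ᶠ k : ℕ in atTop, C₀ / (2 * (QCDRegularisation.canonicalAF Nf).L k + 1 : ℝ) <
      c * ((QCDRegularisation.canonicalAF Nf).a k * m / (QCDRegularisation.canonicalAF Nf).Zm k) :=
  bcProviso_eventually_of_growth _ (tendsto_canonicalAF_growth Nf) C₀ hc hm

end Summit.QuantumFields.QCD.Theorems.ExtinctionBuildsQCD.Negative.VolumeGrowth
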